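import Summits.QuantumFields.YangMills.Theorems.BalabanUVNodesN21LowCentreEndAtSUNBlockChartRecordAnalytic
import Summits.QuantumFields.YangMills.Theorems.BalabanUVNodesN21ChartExponentConvexityLocalSUN

/-!
# N21 (NE7c) · THE [LF-II] §1-LETTERS END ON THE EXPONENTIAL `SU(N)` BLOCK CHART, II″: the UNDRESSED record species with
# the convexity binder discharged by the DIAMETER-FREE analytic value row (dag-n21-w3 g4's ★★′-loc), + A6∕A2 witnesses

Width seat pub-ymgap-dag-n21-w4 (g2; director-ym R399 (3a) ∕ HUMAN RULING D-0149; located HAND «P2-R» of dag-n21-w3 g3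
inside WIDTH-209 N21 piece 2 — second file), node N21 = NE7c (single-run shell-weight bound, NOT PRINTED in [Bałaban
1983–89], NOT proved), lane K3⁷ `SpineGivenEndpointR13SepCoPH` (stmt-QuantumFields-20544, `--kind proof --supports … --as
helper`).  Companion of `…N21LowCentreEndAtSUNBlockChartRecordAnalytic` (this seat's file 1: the three UNDRESSED record
theorems with `hφ` replaced by dag-n21-w3 g3's ★★′, which carries the binder `hdiam : diam K < r`).  Consumes BY NAME:
dag-n21-w1 g2's `…N21LowCentreEndAtSUNBlockChartRecord` (★★★★ ∕ ★★★ ∕ ★★★) and dag-n21-w3 g4's `…N21ChartExponentConvexityLocalSUN`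
(★★′-loc `convexOn_blockChartSU_expansion_of_analyticSupBound_local`: convexity is LOCAL along segments, Cauchy's estimate at
`n = 2`, so the analyticity width `r` is INDEPENDENT of the kept cut's size — print's regime: [LF-II] p. 358 («extended analytically on
G^c-valued configurations …», the (1.2) chart itself being p. 357) ∕ [B13] (1.34)).
THEOREMS ONLY: 0 `def`, 0 `sorry`; count-neutral.

WHAT IS PROVED ([textbook] + composition BY NAME).  File 1's three ★ with `hdiam` DROPPED: `0 < r` is displayed instead,
and the convexity clause reads `4·d·(100M)^{d+1}·S ≤ γ₀·r²` (constant `4`, was `16`):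
* §1 ★-loc `slotAntiConcentration_blockChartSU_chartLetter_analytic_local` (the chart-letter species);
* §2 ★-loc `fibreAC_of_sect1Letters_expChartSU_analytic_local` ∕ ★-loc `termFibreAC_of_sect1Letters_expChartSU_analytic_local`
  (the END at one block ∕ one term fibre law of the record through dag-n21-w2's JUNCTION №3; `hlaw`∕`hdens`∕`hread` verbatim);
* §3 A6∕A2 `chartLetter_blockChartSU_analytic_local_binders_inhabited`: EVERY binder of §1 ★-loc discharged in the kernel at
  `N = 2` for every block and every flat coordinate `q₀` — kept cut `closedBall 0 2` (diameter `4`), exponent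
  `½Σ‖z b′‖² + 10⁻⁴·z_{q₀}³` with its (1.2) expansion, rows at `γ₀ = 1, d = 1, M = 1∕100, B₃ = 1∕192, R_k = 0, W_V = 8·10⁻⁴`,
  letter `θ = 3, ρ = ½`, and analyticity width `r = 1 < 4 = diam K`: file 1's `hdiam` FAILS at these letters while ★-loc fires
  (value row `‖10⁻⁴·u_{q₀}³‖ ≤ 27·10⁻⁴` on the `1`-balls about the real points of the cut, `‖u_{q₀}‖ < 3`; convexity clause
  `4·1·1·(27·10⁻⁴) ≤ 1·1²`; END clause `16·(1∕64 + 8·10⁻⁴)·3 ≤ (3·½)²`) · `chartLetter_blockChartSU_analytic_local_binders_inhabited_oneBond`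
  (one concrete bond and coordinate).

HONEST FRAMING.  [textbook] convex analysis already in the tree + composition BY NAME of landed files; the located letters
(`A`, `ℓ`, `Φ`, `r`, `S` ↔ [LF-II] (1.2) ∕ [B13] Lemma 2 members; `hlaw`, `hdens`, the rows) are HYPOTHESES, NOT asserted; the
witnesses are satisfiability witnesses of the binder list on a toy, not estimates on Bałaban's measure; nothing of Bałaban's
asserted; (M1) ∕ NE7c NOT PRINTED ∕ NOT proved; N21 NOT discharged; K3⁷ NOT claimed; counts unmoved (typed 28∕28 ·
discharged 5∕27 work-bound, chair's A 5∕28); never a count claim; one finite 𝕋⁴ at fixed ε — R4 would close only the conditional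
finite-𝕋⁴ rung
`BalabanLadder.UV`, NOT the Yang–Mills mass gap (Clay); nothing about ℝ⁴ ∕ OS.
-/

set_option autoImplicit false

noncomputable section

open MeasureTheory Set Function Finset Matrix Metric
open scoped ENNReal BigOperators

namespace Summit.QuantumFields.YangMills.Theorems.N21LowCentreEndAtSUNBlockChartRecordAnalyticLocal

open Literature.MathematicalPhysics.QuantumFieldTheory.Balaban1983to89
open Literature.MathematicalPhysics.QuantumFieldTheory.Balaban1983to89.T4Continuum
open Literature.MathematicalPhysics.QuantumFieldTheory.Balaban1983to89.Node00 hiding dimSU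
open Literature.MathematicalPhysics.QuantumFieldTheory.Balaban1983to89.T4ShellMeasure (SlotAntiConcentration)
open Literature.MathematicalPhysics.QuantumFieldTheory.Balaban1983to89.T4ShellMeasureDet (blockLaw)
open Literature.MathematicalPhysics.QuantumFieldTheory.Balaban1983to89.B16Sect1Wilson (Ineq16 Ineq19)
open Summit.QuantumFields.BalabanUV.T4Continuum.ShellMeasureExpChartSUN
  (SUN ChartSU BlockChartSU dimSU dimSU_eq expFibreChartSU chartWeightSU)
open Summit.QuantumFields.BalabanUV.T4Continuum.ShellMeasureScalingSUN (windowSU)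
open Summit.QuantumFields.BalabanUV.T4Continuum.ShellMeasureExpJacobianSUN (expJacWeightSU)
open Summit.QuantumFields.BalabanUV.T4Continuum.ShellMeasureExpHaarAreaSUN (kappaSU)
open Summit.QuantumFields.YangMills.Theorems.N21ShellSplitOfRecord13CoPH (blockReading blockFibreLawOfDatum₉ termFibreLawOfDatum₉)
open Summit.QuantumFields.YangMills.Theorems.N21LowCentreEndAtSUNBlockChart (sum_sq_flatten)
open Summit.QuantumFields.YangMills.Theorems.N21LowCentreEndAtSUNBlockChartRecord
  (slotAntiConcentration_blockChartSU_chartLetter fibreAC_of_sect1Letters_expChartSU termFibreAC_of_sect1Letters_expChartSU)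
open Summit.QuantumFields.YangMills.Theorems.N21ChartExponentConvexitySUN (norm_flat_le)
open Summit.QuantumFields.YangMills.Theorems.N21ChartExponentConvexityLocalSUN
  (convexOn_blockChartSU_expansion_of_analyticSupBound_local)

/-! ## §1  ★-loc The chart-letter species, convexity binder discharged by the DIAMETER-FREE analytic value row -/

section ChartLetter

variable {N : ℕ} {P : Params} {j : ℕ}

/-- ★-loc **(M1) FOR THE CHART's OWN LETTER `‖z‖ = max_{b′} ‖B′(b′)‖` UNDER THE CUT (1.2) CHART LAW — CONVEXITY BINDER
DISCHARGED WITHOUT A DIAMETER BINDER.**  File 1's ★ `slotAntiConcentration_blockChartSU_chartLetter_analytic` with `hdiam`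
DROPPED: `hφ` of dag-n21-w1 g2's ★★★★ is produced by dag-n21-w3 g4's ★★′-loc from `Qf v = flat v ⬝ᵥ (A *ᵥ flat v)`, (1.9) for
every `v`, `lin = ⇑ℓ`, `Vt = Re Φ ∘ ι ∘ flat` with `Φ` complex differentiable and `‖Φ‖ ≤ S` on the `r`-balls about the real
points of `K`, `0 < r`, and the clause `4·d·(100M)^{d+1}·S ≤ γ₀·r²`.  Every other binder verbatim. [textbook] -/
theorem slotAntiConcentration_blockChartSU_chartLetter_analytic_local (hN : 2 ≤ N) (b : Finset (PBond P j))
    (hb : b.Nonempty) (K : Set (BlockChartSU N b)) (φ Qf lin Vt : BlockChartSU N b → ℝ)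
    (hg : Measurable fun z : BlockChartSU N b => K.indicator (fun w => ENNReal.ofReal (Real.exp (-φ w))) z)
    {θ ρ γ₀ M B₃ M₀ A₀ p₀g Rk WV : ℝ} {d : ℕ}
    (hθ : 0 < θ) (hρ0 : 0 < ρ) (hρ1 : ρ < 1) (hd : 1 ≤ d) (hM : 0 < M) (hγ₀ : 0 < γ₀)
    (hW : 0 ≤ 3 * B₃ * M₀ * A₀ ^ 2 * p₀g ^ 2 * Real.exp (-Rk) * (100 * M) ^ 4 + WV)
    (hK : Convex ℝ K) (h0K : (0 : BlockChartSU N b) ∈ K)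
    (hexp : ∀ v ∈ K, φ v = φ 0 + 1 / 2 * Qf v + lin v + Vt v)
    -- ★★′-loc's letters replacing `hφ`
    (A : Matrix (↥b × Fin (dimSU N)) (↥b × Fin (dimSU N)) ℝ)
    (hQf : ∀ v, Qf v = (fun q : ↥b × Fin (dimSU N) => v q.1 q.2) ⬝ᵥ (A *ᵥ fun q => v q.1 q.2))
    (h19 : ∀ v, Ineq19 (Qf v) (∑ i, ‖v i‖ ^ 2) γ₀ d M)
    (h16 : ∀ v ∈ K, Ineq16 (lin v) B₃ M₀ A₀ p₀g Rk M)
    (ℓ : BlockChartSU N b →ₗ[ℝ] ℝ) (hlin : ∀ v, lin v = ℓ v)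
    (hV : ∀ v ∈ K, |Vt v| ≤ WV)
    (Φ : (↥b × Fin (dimSU N) → ℂ) → ℂ) {r S : ℝ} (hr : 0 < r)
    (hVtΦ : ∀ x ∈ K, Vt x = (Φ fun q => ((x q.1 q.2 : ℝ) : ℂ)).re)
    (hΦd : ∀ x ∈ K, DifferentiableOn ℂ Φ (ball (fun q => ((x q.1 q.2 : ℝ) : ℂ)) r))
    (hΦS : ∀ x ∈ K, ∀ u ∈ ball (fun q : ↥b × Fin (dimSU N) => ((x q.1 q.2 : ℝ) : ℂ)) r, ‖Φ u‖ ≤ S)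
    (hconv : 4 * d * (100 * M) ^ (d + 1) * S ≤ γ₀ * r ^ 2)
    -- the END clause of the chart-letter species
    (hclause : 16 * (3 * B₃ * M₀ * A₀ ^ 2 * p₀g ^ 2 * Real.exp (-Rk) * (100 * M) ^ 4 + WV) * d
      * (100 * M) ^ (d + 1) * dimSU N ≤ γ₀ * (θ * (1 - ρ)) ^ 2) :
    SlotAntiConcentration
      (((volume : Measure (BlockChartSU N b)).withDensity fun z =>
          K.indicator (fun w => ENNReal.ofReal (Real.exp (-φ w))) z).restrict
        ({z : BlockChartSU N b | ‖z‖ < θ} ∩ univ))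
      (fun z : BlockChartSU N b => ‖z‖) θ ρ (3 * ((b.card : ℝ) * dimSU N + 1) * (1 + 0) / (1 * (1 - ρ))) :=
  slotAntiConcentration_blockChartSU_chartLetter hN b hb K φ Qf lin Vt hg hθ hρ0 hρ1 hd hM hγ₀ hW hK
    (convexOn_blockChartSU_expansion_of_analyticSupBound_local b hK φ Qf lin Vt (φ 0) hexp A hQf hd hM h19 ℓ hlin Φ hr
      hVtΦ hΦd hΦS hconv)
    h0K hexp (fun v _ => h19 v) h16 hV hclause

end ChartLetter

/-! ## §2  ★-loc The END at one block ∕ term fibre law of the record, DIAMETER-FREE analytic value row -/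

section AtRecord

variable (F : T4Family) (N : ℕ) [NeZero N] (ϑ : Stage9Params F N) (Dt : FiniteEpsData F (SU N)) (g₀ : ℕ → ℝ)
  (os : List (ULoop F)) (p : B12.RunParams) (g : ℕ → ℝ) (k : ℕ)

/-- ★-loc **THE [LF-II] §1-LETTERS END AT ONE BLOCK FIBRE LAW OF THE RECORD THROUGH THE EXPONENTIAL `SU(N)` BLOCK CHART —
CONVEXITY BINDER DISCHARGED WITHOUT A DIAMETER BINDER.**  File 1's ★ `fibreAC_of_sect1Letters_expChartSU_analytic` with
`hdiam` DROPPED (`0 < r` displayed; clause `4·d·(100M)^{d+1}·S₂ ≤ γ₀·r²`); dag-n21-w2's JUNCTION №3 letters `hlaw`, `hdens`,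
`hread` and every other binder verbatim.  LOCATED junction. [bookkeeping] -/
theorem fibreAC_of_sect1Letters_expChartSU_analytic_local (hN : 2 ≤ N) (t : ℝ)
    (a : ↥(cubeIndices (F.P p.K) (cubeSide (F.P p.K).L ϑ.ν.M₂ (RkOfRecord (F.P p.K).L ϑ.ν.r (g k)) k)))
    (b : Finset (PBond (F.P p.K) k)) (hb : b.Nonempty) (x : GaugeField (F.P p.K) k (SU N))
    {S : ℝ} (hS : 0 ≤ S) (hSπ : S ≤ Real.pi) (c : GaugeField (F.P p.K) k (SU N))
    {R : (↥b → SU N) → ℝ≥0∞} (hR : Measurable R)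
    (hlaw : blockFibreLawOfDatum₉ F N ϑ Dt g₀ os p g k t a b x = (blockLaw b).withDensity fun y => windowSU b c S y * R y)
    {u : GaugeField (F.P p.K) k (SU N) → ℝ} (hu : Measurable u)
    -- §1's frame on the chart space
    (K : Set (BlockChartSU N b)) (φ Qf lin Vt : BlockChartSU N b → ℝ)
    (hg : Measurable fun z : BlockChartSU N b => K.indicator (fun w => ENNReal.ofReal (Real.exp (-φ w))) z)
    {U : BlockChartSU N b → ℝ} (hUm : Measurable U)
    {C Env : Set (BlockChartSU N b)} (hC : MeasurableSet C) (hEnv : MeasurableSet Env)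
    {θ ρ σ κ₀ Q L γ₀ M B₃ M₀ A₀ p₀g Rk WV : ℝ} {d : ℕ}
    (hθ : 0 < θ) (hρ0 : 0 < ρ) (hρ1 : ρ < 1) (hρσ : ρ + σ ≤ 1) (hκ : 0 < κ₀) (hQ0 : 0 ≤ Q) (hL : 0 < L)
    (hd : 1 ≤ d) (hM : 0 < M) (hγ₀ : 0 < γ₀)
    (hW : 0 ≤ 3 * B₃ * M₀ * A₀ ^ 2 * p₀g ^ 2 * Real.exp (-Rk) * (100 * M) ^ 4 + WV)
    (hK : Convex ℝ K) (h0K : (0 : BlockChartSU N b) ∈ K)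
    (hexp : ∀ v ∈ K, φ v = φ 0 + 1 / 2 * Qf v + lin v + Vt v)
    -- ★★′-loc's letters replacing `hφ`
    (A : Matrix (↥b × Fin (dimSU N)) (↥b × Fin (dimSU N)) ℝ)
    (hQf : ∀ v, Qf v = (fun q : ↥b × Fin (dimSU N) => v q.1 q.2) ⬝ᵥ (A *ᵥ fun q => v q.1 q.2))
    (h19 : ∀ v, Ineq19 (Qf v) (∑ i, ‖v i‖ ^ 2) γ₀ d M)
    (h16 : ∀ v ∈ K, Ineq16 (lin v) B₃ M₀ A₀ p₀g Rk M)
    (ℓ : BlockChartSU N b →ₗ[ℝ] ℝ) (hlin : ∀ v, lin v = ℓ v)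
    (hV : ∀ v ∈ K, |Vt v| ≤ WV)
    (Φ : (↥b × Fin (dimSU N) → ℂ) → ℂ) {r S₂ : ℝ} (hr : 0 < r)
    (hVtΦ : ∀ z ∈ K, Vt z = (Φ fun q => ((z q.1 q.2 : ℝ) : ℂ)).re)
    (hΦd : ∀ z ∈ K, DifferentiableOn ℂ Φ (ball (fun q => ((z q.1 q.2 : ℝ) : ℂ)) r))
    (hΦS : ∀ z ∈ K, ∀ w ∈ ball (fun q : ↥b × Fin (dimSU N) => ((z q.1 q.2 : ℝ) : ℂ)) r, ‖Φ w‖ ≤ S₂)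
    (hconv : 4 * d * (100 * M) ^ (d + 1) * S₂ ≤ γ₀ * r ^ 2)
    -- the statistic's binders and the END clause, verbatim
    (hUL : ∀ z z' : BlockChartSU N b, U z - U z' ≤ L * ‖z - z'‖)
    (hUc : U 0 ≤ σ * θ)
    (hclause : 16 * (3 * B₃ * M₀ * A₀ ^ 2 * p₀g ^ 2 * Real.exp (-Rk) * (100 * M) ^ 4 + WV) * d
      * (100 * M) ^ (d + 1) * (dimSU N * L ^ 2) ≤ γ₀ * (θ * (1 - ρ - σ)) ^ 2)
    (henv : ∀ l ∈ Icc (1 - 1 / ((b.card : ℝ) * dimSU N + 1)) 1, ∀ z : BlockChartSU N b,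
      θ * (1 - ρ) ≤ U z → U z < θ → z ∈ C → l • z ∈ Env)
    (hRT : ∀ z : BlockChartSU N b, θ * (1 - ρ) ≤ U z → U z < θ → z ∈ C → ∀ s : ℝ, 1 ≤ s →
      θ * (1 - ρ) ≤ U (s • z) → U (s • z) < θ → s • z ∈ C → U z + κ₀ * (θ * (1 - ρ)) * (s - 1) ≤ U (s • z))
    (hQ : ((volume : Measure (BlockChartSU N b)).withDensity fun z =>
        K.indicator (fun w => ENNReal.ofReal (Real.exp (-φ w))) z) (Env \ ({z | U z < θ} ∩ C))
      ≤ ENNReal.ofReal Q * ((volume : Measure (BlockChartSU N b)).withDensity fun z =>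
        K.indicator (fun w => ENNReal.ofReal (Real.exp (-φ w))) z) ({z | U z < θ} ∩ C))
    -- the reading identity on the window and the density presentation
    (hread : ∀ z ∈ closedBall (0 : BlockChartSU N b) S, blockReading N u b x (expFibreChartSU b c z) = U z)
    (hdens : (fun z : BlockChartSU N b => chartWeightSU b S (expJacWeightSU (kappaSU N)) z * R (expFibreChartSU b c z))
      =ᵐ[volume] ({z | U z < θ} ∩ C).indicator fun z => K.indicator (fun w => ENNReal.ofReal (Real.exp (-φ w))) z) :
    SlotAntiConcentration (blockFibreLawOfDatum₉ F N ϑ Dt g₀ os p g k t a b x) (blockReading N u b x) θ ρ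
      (3 * ((b.card : ℝ) * dimSU N + 1) * (1 + Q) / (κ₀ * (1 - ρ))) :=
  fibreAC_of_sect1Letters_expChartSU F N ϑ Dt g₀ os p g k hN t a b hb x hS hSπ c hR hlaw hu K φ Qf lin Vt hg hUm hC hEnv
    hθ hρ0 hρ1 hρσ hκ hQ0 hL hd hM hγ₀ hW hK
    (convexOn_blockChartSU_expansion_of_analyticSupBound_local b hK φ Qf lin Vt (φ 0) hexp A hQf hd hM h19 ℓ hlin Φ hr
      hVtΦ hΦd hΦS hconv)
    h0K hexp (fun v _ => h19 v) h16 hV hUL hUc hclause henv hRT hQ hread hdens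

/-- ★-loc **THE SAME AT ONE TERM's FIBRE LAW** `termFibreLawOfDatum₉ … t s b x`: file 1's ★
`termFibreAC_of_sect1Letters_expChartSU_analytic` with `hdiam` DROPPED.  LOCATED junction. [bookkeeping] -/
theorem termFibreAC_of_sect1Letters_expChartSU_analytic_local (hN : 2 ≤ N) (t : ℝ)
    (s : SeqOfRecord F ϑ.ν ϑ.τ9.M g p.K k)
    (b : Finset (PBond (F.P p.K) k)) (hb : b.Nonempty) (x : GaugeField (F.P p.K) k (SU N))
    {S : ℝ} (hS : 0 ≤ S) (hSπ : S ≤ Real.pi) (c : GaugeField (F.P p.K) k (SU N))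
    {R : (↥b → SU N) → ℝ≥0∞} (hR : Measurable R)
    (hlaw : termFibreLawOfDatum₉ F N ϑ Dt g₀ os p g k t s b x = (blockLaw b).withDensity fun y => windowSU b c S y * R y)
    {u : GaugeField (F.P p.K) k (SU N) → ℝ} (hu : Measurable u)
    (K : Set (BlockChartSU N b)) (φ Qf lin Vt : BlockChartSU N b → ℝ)
    (hg : Measurable fun z : BlockChartSU N b => K.indicator (fun w => ENNReal.ofReal (Real.exp (-φ w))) z)
    {U : BlockChartSU N b → ℝ} (hUm : Measurable U)
    {C Env : Set (BlockChartSU N b)} (hC : MeasurableSet C) (hEnv : MeasurableSet Env)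
    {θ ρ σ κ₀ Q L γ₀ M B₃ M₀ A₀ p₀g Rk WV : ℝ} {d : ℕ}
    (hθ : 0 < θ) (hρ0 : 0 < ρ) (hρ1 : ρ < 1) (hρσ : ρ + σ ≤ 1) (hκ : 0 < κ₀) (hQ0 : 0 ≤ Q) (hL : 0 < L)
    (hd : 1 ≤ d) (hM : 0 < M) (hγ₀ : 0 < γ₀)
    (hW : 0 ≤ 3 * B₃ * M₀ * A₀ ^ 2 * p₀g ^ 2 * Real.exp (-Rk) * (100 * M) ^ 4 + WV)
    (hK : Convex ℝ K) (h0K : (0 : BlockChartSU N b) ∈ K)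
    (hexp : ∀ v ∈ K, φ v = φ 0 + 1 / 2 * Qf v + lin v + Vt v)
    (A : Matrix (↥b × Fin (dimSU N)) (↥b × Fin (dimSU N)) ℝ)
    (hQf : ∀ v, Qf v = (fun q : ↥b × Fin (dimSU N) => v q.1 q.2) ⬝ᵥ (A *ᵥ fun q => v q.1 q.2))
    (h19 : ∀ v, Ineq19 (Qf v) (∑ i, ‖v i‖ ^ 2) γ₀ d M)
    (h16 : ∀ v ∈ K, Ineq16 (lin v) B₃ M₀ A₀ p₀g Rk M)
    (ℓ : BlockChartSU N b →ₗ[ℝ] ℝ) (hlin : ∀ v, lin v = ℓ v)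
    (hV : ∀ v ∈ K, |Vt v| ≤ WV)
    (Φ : (↥b × Fin (dimSU N) → ℂ) → ℂ) {r S₂ : ℝ} (hr : 0 < r)
    (hVtΦ : ∀ z ∈ K, Vt z = (Φ fun q => ((z q.1 q.2 : ℝ) : ℂ)).re)
    (hΦd : ∀ z ∈ K, DifferentiableOn ℂ Φ (ball (fun q => ((z q.1 q.2 : ℝ) : ℂ)) r))
    (hΦS : ∀ z ∈ K, ∀ w ∈ ball (fun q : ↥b × Fin (dimSU N) => ((z q.1 q.2 : ℝ) : ℂ)) r, ‖Φ w‖ ≤ S₂)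
    (hconv : 4 * d * (100 * M) ^ (d + 1) * S₂ ≤ γ₀ * r ^ 2)
    (hUL : ∀ z z' : BlockChartSU N b, U z - U z' ≤ L * ‖z - z'‖)
    (hUc : U 0 ≤ σ * θ)
    (hclause : 16 * (3 * B₃ * M₀ * A₀ ^ 2 * p₀g ^ 2 * Real.exp (-Rk) * (100 * M) ^ 4 + WV) * d
      * (100 * M) ^ (d + 1) * (dimSU N * L ^ 2) ≤ γ₀ * (θ * (1 - ρ - σ)) ^ 2)
    (henv : ∀ l ∈ Icc (1 - 1 / ((b.card : ℝ) * dimSU N + 1)) 1, ∀ z : BlockChartSU N b,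
      θ * (1 - ρ) ≤ U z → U z < θ → z ∈ C → l • z ∈ Env)
    (hRT : ∀ z : BlockChartSU N b, θ * (1 - ρ) ≤ U z → U z < θ → z ∈ C → ∀ s' : ℝ, 1 ≤ s' →
      θ * (1 - ρ) ≤ U (s' • z) → U (s' • z) < θ → s' • z ∈ C → U z + κ₀ * (θ * (1 - ρ)) * (s' - 1) ≤ U (s' • z))
    (hQ : ((volume : Measure (BlockChartSU N b)).withDensity fun z =>
        K.indicator (fun w => ENNReal.ofReal (Real.exp (-φ w))) z) (Env \ ({z | U z < θ} ∩ C))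
      ≤ ENNReal.ofReal Q * ((volume : Measure (BlockChartSU N b)).withDensity fun z =>
        K.indicator (fun w => ENNReal.ofReal (Real.exp (-φ w))) z) ({z | U z < θ} ∩ C))
    (hread : ∀ z ∈ closedBall (0 : BlockChartSU N b) S, blockReading N u b x (expFibreChartSU b c z) = U z)
    (hdens : (fun z : BlockChartSU N b => chartWeightSU b S (expJacWeightSU (kappaSU N)) z * R (expFibreChartSU b c z))
      =ᵐ[volume] ({z | U z < θ} ∩ C).indicator fun z => K.indicator (fun w => ENNReal.ofReal (Real.exp (-φ w))) z) :
    SlotAntiConcentration (termFibreLawOfDatum₉ F N ϑ Dt g₀ os p g k t s b x) (blockReading N u b x) θ ρ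
      (3 * ((b.card : ℝ) * dimSU N + 1) * (1 + Q) / (κ₀ * (1 - ρ))) :=
  termFibreAC_of_sect1Letters_expChartSU F N ϑ Dt g₀ os p g k hN t s b hb x hS hSπ c hR hlaw hu K φ Qf lin Vt hg hUm hC
    hEnv hθ hρ0 hρ1 hρσ hκ hQ0 hL hd hM hγ₀ hW hK
    (convexOn_blockChartSU_expansion_of_analyticSupBound_local b hK φ Qf lin Vt (φ 0) hexp A hQf hd hM h19 ℓ hlin Φ hr
      hVtΦ hΦd hΦS hconv)
    h0K hexp (fun v _ => h19 v) h16 hV hUL hUc hclause henv hRT hQ hread hdens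

end AtRecord

/-! ## §3  A6∕A2 witnesses: every binder of §1 ★-loc discharged at a width `r = 1 < diam K = 4` (`N = 2`) -/

section Witness

variable {P : Params} {j : ℕ}

/-- **A6∕A2 WITNESS OF §1 ★-loc, FOR EVERY BLOCK OF EVERY LATTICE AND EVERY FLAT COORDINATE `q₀`** (director-ym STANDING A6
RULE №189 (3)): `N = 2` (`d_2 = 3`), kept cut `K = closedBall 0 2` (convex, `∋ 0`, diameter `4`), exponent
`φ z = ½Σ_{b′}‖z b′‖² + 10⁻⁴·z_{q₀}³` with the (1.2) expansion (`Qf = Σ‖z b′‖² = flat z ⬝ᵥ (1 *ᵥ flat z)` by `sum_sq_flatten`,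
`lin = 0 = ⇑0`, `Vt z = 10⁻⁴·z_{q₀}³ = Re Φ(ι(flat z))`, `Φ u = 10⁻⁴·u_{q₀}³` entire), rows (1.9) ∕ (1.6) at `γ₀ = 1`, `d = 1`,
`M = 1∕100` (`100M = 1`), `B₃ = 1∕192`, `M₀ = A₀ = p₀(g) = 1`, `R_k = 0` (`W = 1∕64`), `|Vt| ≤ W_V = 8·10⁻⁴` on the cut, letter
`θ = 3`, `ρ = ½`, and analyticity width `r = 1 < 4 = diam K` — file 1's `hdiam` FAILS at these letters (with the value letter
PINNED at `S = 27·10⁻⁴`: `hΦS` caps `r ≤ 1` while `hdiam` needs `r > 4`; re-choosing `S` the global road fires here too, e.g. `r = 5`,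
`S = 343·10⁻⁴` — so the witness shows «a width below the diameter is admissible», not «the global road is void here») while
★-loc fires: the VALUE row is `‖10⁻⁴·u_{q₀}³‖ ≤ 27·10⁻⁴` on the sup-norm `1`-balls about the real points of the cut (`‖u_{q₀}‖ < 3`
there), the convexity clause reads `4·1·1·(27·10⁻⁴) ≤ 1·1²`, the END clause
`16·(1∕64 + 8·10⁻⁴)·1·1·3 ≤ 1·(3·½)²` — every hypothesis of §1 ★-loc discharged in the kernel.  A satisfiability witness of the
joint binder list, not an estimate on Bałaban's measure. [textbook] -/
theorem chartLetter_blockChartSU_analytic_local_binders_inhabited (b : Finset (PBond P j)) (q₀ : ↥b × Fin (dimSU 2)) :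
    SlotAntiConcentration
      (((volume : Measure (BlockChartSU 2 b)).withDensity fun z =>
          (closedBall (0 : BlockChartSU 2 b) 2).indicator
            (fun w => ENNReal.ofReal (Real.exp (-((∑ i, ‖w i‖ ^ 2) / 2 + (1 / 10000 : ℝ) * w q₀.1 q₀.2 ^ 3)))) z).restrict
        ({z : BlockChartSU 2 b | ‖z‖ < 3} ∩ univ))
      (fun z : BlockChartSU 2 b => ‖z‖) 3 (1 / 2) (3 * ((b.card : ℝ) * dimSU 2 + 1) * (1 + 0) / (1 * (1 - 1 / 2))) := by
  have hb : b.Nonempty := ⟨q₀.1, q₀.1.2⟩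
  have hφc : Continuous fun w : BlockChartSU 2 b => (∑ i, ‖w i‖ ^ 2) / 2 + (1 / 10000 : ℝ) * w q₀.1 q₀.2 ^ 3 := by
    refine ((continuous_finsetSum _ fun i _ => ((continuous_apply i).norm).pow 2).div_const 2).add ?_
    have hq : Continuous fun w : BlockChartSU 2 b => w q₀.1 q₀.2 :=
      (PiLp.continuous_apply 2 (fun _ : Fin (dimSU 2) => ℝ) q₀.2).comp (continuous_apply q₀.1)
    exact (hq.pow 3).const_mul _
  have hg : Measurable fun z : BlockChartSU 2 b => (closedBall (0 : BlockChartSU 2 b) 2).indicator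
      (fun w => ENNReal.ofReal (Real.exp (-((∑ i, ‖w i‖ ^ 2) / 2 + (1 / 10000 : ℝ) * w q₀.1 q₀.2 ^ 3)))) z :=
    (ENNReal.measurable_ofReal.comp (Real.measurable_exp.comp hφc.measurable.neg)).indicator measurableSet_closedBall
  have hd2 : (dimSU 2 : ℝ) = 3 := by
    rw [dimSU_eq]
    norm_num
  have hcoord : ∀ z : BlockChartSU 2 b, |z q₀.1 q₀.2| ≤ ‖z‖ := fun z =>
    (norm_le_pi_norm (fun q : ↥b × Fin (dimSU 2) => z q.1 q.2) q₀).trans (norm_flat_le b z)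
  refine slotAntiConcentration_blockChartSU_chartLetter_analytic_local le_rfl b hb (closedBall 0 2)
    (fun w => (∑ i, ‖w i‖ ^ 2) / 2 + (1 / 10000 : ℝ) * w q₀.1 q₀.2 ^ 3) (fun w => ∑ i, ‖w i‖ ^ 2) (fun _ => 0)
    (fun w => (1 / 10000 : ℝ) * w q₀.1 q₀.2 ^ 3) hg (γ₀ := 1) (M := 1 / 100) (B₃ := 1 / 192) (M₀ := 1) (A₀ := 1) (p₀g := 1)
    (Rk := 0) (WV := 8 / 10000) (d := 1) (by norm_num) (by norm_num) (by norm_num) le_rfl (by norm_num) one_pos ?_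
    (convex_closedBall _ _) (mem_closedBall_self zero_le_two) ?_ 1 ?_ ?_ ?_ 0 (fun _ => rfl) ?_
    (fun u => (1 / 10000 : ℂ) * u q₀ ^ 3) (r := 1) (S := 27 / 10000) one_pos ?_ ?_ ?_ (by norm_num) ?_
  · -- hW
    norm_num
  · -- the (1.2) expansion
    intro v _
    have h0 : (∑ i, ‖(0 : BlockChartSU 2 b) i‖ ^ 2) = 0 := by simp
    simp only [h0]
    show (∑ i, ‖v i‖ ^ 2) / 2 + (1 / 10000 : ℝ) * v q₀.1 q₀.2 ^ 3 =
      0 / 2 + 1 / 10000 * (0 : BlockChartSU 2 b) q₀.1 q₀.2 ^ 3 + 1 / 2 * (∑ i, ‖v i‖ ^ 2) + 0 +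
        (1 / 10000 : ℝ) * v q₀.1 q₀.2 ^ 3
    simp only [Pi.zero_apply, PiLp.zero_apply]
    ring
  · -- the matrix form `A = 1`
    intro v
    rw [one_mulVec, dotProduct, ← sum_sq_flatten b v]
    exact Finset.sum_congr rfl fun q _ => sq _
  · -- (1.9) for every v
    intro v
    have hS : 0 ≤ ∑ i, ‖v i‖ ^ 2 := Finset.sum_nonneg fun i _ => sq_nonneg _
    show (1 : ℝ) / (2 * ((1 : ℕ) : ℝ) * (100 * (1 / 100)) ^ (1 + 1)) * (∑ i, ‖v i‖ ^ 2) ≤ ∑ i, ‖v i‖ ^ 2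
    calc (1 : ℝ) / (2 * ((1 : ℕ) : ℝ) * (100 * (1 / 100)) ^ (1 + 1)) * (∑ i, ‖v i‖ ^ 2)
        = 1 / 2 * (∑ i, ‖v i‖ ^ 2) := by norm_num
      _ ≤ ∑ i, ‖v i‖ ^ 2 := by linarith
  · -- (1.6) for lin = 0
    intro v _
    unfold Ineq16
    norm_num
  · -- |Vt| ≤ W_V on the cut (`|z_{q₀}| ≤ 2`)
    intro v hv
    rw [mem_closedBall, dist_zero_right] at hv
    have hv0 : |v q₀.1 q₀.2| ≤ 2 := (hcoord v).trans hv
    rw [abs_mul, abs_of_pos (by norm_num : (0 : ℝ) < 1 / 10000), abs_pow]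
    have : |v q₀.1 q₀.2| ^ 3 ≤ 8 := by
      calc |v q₀.1 q₀.2| ^ 3 ≤ 2 ^ 3 := pow_le_pow_left₀ (abs_nonneg _) hv0 3
        _ = 8 := by norm_num
    linarith
  · -- Vt = Re Φ ∘ ι ∘ flat
    intro z _
    simp only [← Complex.ofReal_pow, ← Complex.ofReal_ofNat, ← Complex.ofReal_one, ← Complex.ofReal_div,
      ← Complex.ofReal_mul, Complex.ofReal_re]
  · -- Φ is entire
    intro z _
    exact ((differentiable_const _).mul ((differentiable_apply q₀).pow 3)).differentiableOn
  · -- the VALUE row on the 1-balls: ‖Φ u‖ ≤ 27·10⁻⁴ (`‖u_{q₀}‖ < 3`)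
    intro z hz u hu
    rw [mem_closedBall, dist_zero_right] at hz
    rw [mem_ball, dist_eq_norm] at hu
    have hz0 : |z q₀.1 q₀.2| ≤ 2 := (hcoord z).trans hz
    have hu0 : ‖u q₀ - ((z q₀.1 q₀.2 : ℝ) : ℂ)‖ < 1 :=
      lt_of_le_of_lt (norm_le_pi_norm (u - fun q => ((z q.1 q.2 : ℝ) : ℂ)) q₀) hu
    have hu3 : ‖u q₀‖ ≤ 3 := by
      have : ‖u q₀‖ ≤ ‖u q₀ - ((z q₀.1 q₀.2 : ℝ) : ℂ)‖ + ‖((z q₀.1 q₀.2 : ℝ) : ℂ)‖ := norm_le_norm_sub_add _ _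
      rw [Complex.norm_real, Real.norm_eq_abs] at this
      linarith
    calc ‖(1 / 10000 : ℂ) * u q₀ ^ 3‖ = 1 / 10000 * ‖u q₀‖ ^ 3 := by
          rw [norm_mul, norm_pow]
          norm_num
      _ ≤ 1 / 10000 * 3 ^ 3 := by gcongr
      _ = 27 / 10000 := by norm_num
  · -- the END clause (`dimSU 2 = 3`): `16·(1/64 + 8·10⁻⁴)·3 ≤ (3/2)²`
    rw [hd2]
    norm_num

/-- … and the data exist: ONE CONCRETE BOND AND COORDINATE (`Params.mk 1 3 0 0 …`, scale `0`, the single bond `⟨default, 0⟩`,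
colour coordinate `0 < 3 = d_2`) — the binder list of §1 ★-loc is inhabited outright at a width below the cut's diameter.
[textbook] -/
theorem chartLetter_blockChartSU_analytic_local_binders_inhabited_oneBond :
    ∃ (P : Params) (j : ℕ) (b : Finset (PBond P j)) (q₀ : ↥b × Fin (dimSU 2)),
      SlotAntiConcentration
        (((volume : Measure (BlockChartSU 2 b)).withDensity fun z =>
            (closedBall (0 : BlockChartSU 2 b) 2).indicator
              (fun w => ENNReal.ofReal (Real.exp (-((∑ i, ‖w i‖ ^ 2) / 2 + (1 / 10000 : ℝ) * w q₀.1 q₀.2 ^ 3)))) z).restrict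
          ({z : BlockChartSU 2 b | ‖z‖ < 3} ∩ univ))
        (fun z : BlockChartSU 2 b => ‖z‖) 3 (1 / 2) (3 * ((b.card : ℝ) * dimSU 2 + 1) * (1 + 0) / (1 * (1 - 1 / 2))) := by
  have h3 : 0 < dimSU 2 := by
    rw [dimSU_eq]
    norm_num
  exact ⟨Params.mk 1 3 0 0 le_rfl ⟨⟨1, rfl⟩, Nat.one_lt_two.trans (Nat.lt_succ_self 2)⟩, 0, {⟨default, 0⟩},
    (⟨⟨default, 0⟩, Finset.mem_singleton_self _⟩, ⟨0, h3⟩),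
    chartLetter_blockChartSU_analytic_local_binders_inhabited _ _⟩

end Witness

end Summit.QuantumFields.YangMills.Theorems.N21LowCentreEndAtSUNBlockChartRecordAnalyticLocal

end
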